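import Summits.BirchSwinnertonDyer.BirchSwinnertonDyer.Theorems.RamifiedHeegnerPairLeafPartnerOrdersKernelBaseChange
import Mathlib.RingTheory.Adjoin.Basic
import Mathlib.LinearAlgebra.FreeModule.PID
import Mathlib.LinearAlgebra.Dimension.Free
import Mathlib.LinearAlgebra.Matrix.ToLin
import HarnessLib

/-!
# Route `RamifiedHeegnerPair`, crux U₁ `LeafRankOneUpperAtThree` (stmt-BirchSwinnertonDyer-26022), line `partnerdescent` —
# partner kernel, base change (α) part 2: COORDINATES — the degree-zero module `B̂ ≤ S^ι`, integral matrices read over `S`, saturated lattices as kernels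

HONEST FRAMING. Theorems only; helper file (`--supports stmt-BirchSwinnertonDyer-26022 --as helper`); elementary linear algebra over Mathlib
(`Matrix.mulVec`, `Matrix.map`, `Submodule.span`, `Algebra.adjoin`), continuing ‹…LeafPartnerOrdersKernelBaseChange› (p812051); no number theory,
no named fact, no `sorry`; nothing booked; BSD is proved for no curve. Lead prover bsd-line-rhp-p2 g64, 2026-08-31.

WHY. The (α) base change (LEAD-G63-ASSEMBLY.md §4b) reads the INTEGRAL Brandt data (`ℤ^{Cls O}`, its degree-zero lattice `B`, commuting
integer matrices `G`, a saturated `G`-stable sublattice `Y`) over `S = ℤ₃`: `M = B̂ = {v ∈ S^ι : Σ v = 0}`, operators `X̂ = X.map (ℤ → S)`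
restricted to `M`, `Ŷ = {v ∈ M : Ĉ v = 0}` for an integer matrix `C` cutting out `Y`. This file supplies the coordinate facts the run
(‹…GeneratorsRun›, `dvd_of_generatorsRun`) consumes, for ANY commutative ring `S` (flat over `ℤ` where kernels are concerned), with the
degree-zero module given abstractly by `hM : v ∈ M ↔ Σ v = 0`:
* `exists_basis_coord_eq` — `M` is free with basis `e_c − e_{c₀}` (`c ≠ c₀`) whose coordinate functionals are the evaluations `v ↦ v_c`
  (feeds `forall_exists_pairing_eq_comp_of_basis`: exact Eisenstein needs checking on the `v ↦ v_c` only);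
* `mem_span_image_intCast_of_sum_eq_zero` — `M` is the `S`-span of the images of the integral degree-zero vectors (every `S`-linear identity
  is checked on `B`);
* `sum_eq_sum_of_forall_sum_mulVec_eq_zero`, `sum_map_mulVec_eq_zero` — an integer matrix preserving `B` has constant column sums, hence
  its image over `S` preserves `M`; `forall_sum_mulVec_eq_zero_of_mem_adjoin` — so does every element of `ℤ[G]`;
* `map_intCast_mulVec` — `(X·v)^ = X̂·v̂`; `exists_mem_adjoin_of_mem_closure` — every monomial in the restricted generators acts as `Ĉ`
  for some `C ∈ ℤ[G]` (so `S[Ĝ|_M]` is the `S`-span of `ℤ[G]` read over `S`, via `Algebra.adjoin_eq_span`);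
* `exists_matrix_mem_iff_mulVec_eq_zero` — a SATURATED sublattice `Y ≤ ℤ^ι` is the kernel of an integer matrix (the quotient is free over
  the PID `ℤ`), so that `Ŷ := ker Ĉ ∩ M` is automatically saturated and, by p812051 `mem_span_image_of_map_mulVec_eq_zero`, equals the
  `S`-span of the image of `Y` (`mem_span_image_of_mem_ker`).
[cite: Matsumura1987, Thm. 7.4 (i), Thm. 7.6] [cite: BourbakiAlgebraI1989, Ch. II §1 no. 11, §2 no. 6]
-/

set_option linter.dupNamespace false
set_option autoImplicit false

noncomputable section

namespace Summit.BirchSwinnertonDyer.BirchSwinnertonDyer.Theorems.LeafPartnerOrders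

open Matrix

section DegreeZero

variable {S : Type*} [CommRing S] {ι : Type*} [Fintype ι] [DecidableEq ι]

/-- **The degree-zero module is free with the evaluation functionals as coordinates.** If `M = {v ∈ S^ι : Σ_c v_c = 0}` and `c₀ ∈ ι`,
then `M` has an `S`-basis indexed by `{c // c ≠ c₀}` (the vectors `e_c − e_{c₀}`) whose `c`-th coordinate functional is `v ↦ v_c`.
[cite: BourbakiAlgebraI1989, Ch. II §1 no. 11] -/
theorem exists_basis_coord_eq (M : Submodule S (ι → S)) (hM : ∀ v : ι → S, v ∈ M ↔ ∑ c, v c = 0) (c₀ : ι) :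
    ∃ b : Module.Basis {c : ι // c ≠ c₀} S M, ∀ (k : {c : ι // c ≠ c₀}) (v : M), b.coord k v = (v : ι → S) k := by
  classical
  -- the coordinate equivalence `M ≃ S^{ι ∖ c₀}`
  let toF : M →ₗ[S] ({c : ι // c ≠ c₀} → S) :=
    { toFun := fun v k ↦ (v : ι → S) k
      map_add' := fun v v' ↦ rfl
      map_smul' := fun a v ↦ rfl }
  let ext : ({c : ι // c ≠ c₀} → S) → ι → S := fun u c ↦ if h : c = c₀ then -∑ k, u k else u ⟨c, h⟩
  have hext_mem : ∀ u, ext u ∈ M := by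
    intro u
    rw [hM, Fintype.sum_eq_add_sum_subtype_ne _ c₀]
    have h1 : ext u c₀ = -∑ k, u k := by simp [ext]
    have h2 : ∀ k : {c : ι // c ≠ c₀}, ext u k = u k := fun k ↦ by simp [ext, k.2]
    simp_rw [h1, h2]
    ring
  let e : M ≃ₗ[S] ({c : ι // c ≠ c₀} → S) :=
    { toF with
      invFun := fun u ↦ ⟨ext u, hext_mem u⟩
      left_inv := by
        intro v
        apply Subtype.ext
        funext c
        change ext (fun k ↦ (v : ι → S) k) c = (v : ι → S) c
        by_cases hc : c = c₀
        · subst hc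
          have hv := (hM v).mp v.2
          rw [Fintype.sum_eq_add_sum_subtype_ne _ c] at hv
          simp only [ext, dif_pos]
          linear_combination -hv
        · simp [ext, hc]
      right_inv := by
        intro u
        funext k
        change ext u k = u k
        simp [ext, k.2] }
  refine ⟨Module.Basis.ofEquivFun e, fun k v ↦ ?_⟩
  rw [Module.Basis.coord_apply, Module.Basis.ofEquivFun_repr_apply]
  rfl

/-- **`M` is the `S`-span of the integral degree-zero vectors.** Every `v ∈ S^ι` with `Σ v = 0` is an `S`-combination of the images of
integer vectors of degree zero (indeed of the `e_c − e_{c₀}`). [cite: BourbakiAlgebraI1989, Ch. II §1 no. 11] -/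
theorem mem_span_image_intCast_of_sum_eq_zero (c₀ : ι) (v : ι → S) (hv : ∑ c, v c = 0) :
    v ∈ Submodule.span S ((fun w : ι → ℤ ↦ fun c ↦ (w c : S)) '' {w | ∑ c, w c = 0}) := by
  have hdec : v = ∑ c, v c • (fun d ↦ ((Pi.single c 1 - Pi.single c₀ 1 : ι → ℤ) d : S)) := by
    funext d
    simp only [Finset.sum_apply, Pi.smul_apply, smul_eq_mul, Pi.sub_apply, Int.cast_sub]
    by_cases hd : d = c₀
    · subst hd
      simp only [Pi.single_apply, if_true]
      rw [show ∑ x, v x * (((if d = x then (1 : ℤ) else 0 : ℤ) : S) - ((1 : ℤ) : S)) =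
          ∑ x, (v x * ((if d = x then (1 : ℤ) else 0 : ℤ) : S) - v x) from
          Finset.sum_congr rfl fun x _ ↦ by ring]
      rw [Finset.sum_sub_distrib, hv, sub_zero]
      simp
    · simp [Pi.single_apply, hd]
  rw [hdec]
  refine Submodule.sum_mem _ fun c _ ↦ Submodule.smul_mem _ _ (Submodule.subset_span ⟨_, ?_, rfl⟩)
  simp [Finset.sum_sub_distrib]

/-- An integer matrix preserving the degree-zero lattice has CONSTANT COLUMN SUMS. [folklore] -/
theorem sum_eq_sum_of_forall_sum_mulVec_eq_zero {C : Matrix ι ι ℤ}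
    (hC : ∀ v : ι → ℤ, ∑ c, v c = 0 → ∑ c, (C *ᵥ v) c = 0) (k k' : ι) : ∑ c, C c k = ∑ c, C c k' := by
  by_cases hkk : k = k'
  · rw [hkk]
  have h := hC (Pi.single k 1 - Pi.single k' 1) (by simp [Finset.sum_sub_distrib])
  simp only [mulVec_sub, Pi.sub_apply, Finset.sum_sub_distrib, mulVec_single, MulOpposite.op_one, one_smul] at h
  exact sub_eq_zero.mp h

/-- **An integer matrix preserving `B` preserves `M` over any ring.** [folklore] -/
theorem sum_map_mulVec_eq_zero {C : Matrix ι ι ℤ} (hC : ∀ v : ι → ℤ, ∑ c, v c = 0 → ∑ c, (C *ᵥ v) c = 0)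
    (m : ι → S) (hm : ∑ c, m c = 0) : ∑ c, (C.map (Int.castRingHom S) *ᵥ m) c = 0 := by
  by_cases hι : Nonempty ι
  · obtain ⟨k₀⟩ := hι
    have hcol : ∀ k, ((∑ c, C c k : ℤ) : S) = ((∑ c, C c k₀ : ℤ) : S) := fun k ↦ by
      rw [sum_eq_sum_of_forall_sum_mulVec_eq_zero hC k k₀]
    calc ∑ c, (C.map (Int.castRingHom S) *ᵥ m) c = ∑ k, ((∑ c, C c k : ℤ) : S) * m k := by
            simp only [mulVec, dotProduct, map_apply, Int.coe_castRingHom, Int.cast_sum, Finset.sum_mul]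
            rw [Finset.sum_comm]
      _ = ((∑ c, C c k₀ : ℤ) : S) * ∑ k, m k := by rw [Finset.mul_sum]; exact Finset.sum_congr rfl fun k _ ↦ by rw [hcol k]
      _ = 0 := by rw [hm, mul_zero]
  · rw [not_nonempty_iff] at hι
    exact Finset.sum_of_isEmpty _

/-- **Every element of `ℤ[G]` preserves `B`** when the generators do. [folklore] -/
theorem forall_sum_mulVec_eq_zero_of_mem_adjoin {G : Set (Matrix ι ι ℤ)}
    (hG : ∀ X ∈ G, ∀ v : ι → ℤ, ∑ c, v c = 0 → ∑ c, (X *ᵥ v) c = 0) {C : Matrix ι ι ℤ} (hC : C ∈ Algebra.adjoin ℤ G) :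
    ∀ v : ι → ℤ, ∑ c, v c = 0 → ∑ c, (C *ᵥ v) c = 0 := by
  induction hC using Algebra.adjoin_induction with
  | mem X hX => exact hG X hX
  | algebraMap n =>
      intro v hv
      rw [Algebra.algebraMap_eq_smul_one, smul_mulVec, one_mulVec]
      simp only [Pi.smul_apply, smul_eq_mul, ← Finset.mul_sum, hv, mul_zero]
  | add X X' _ _ ih ih' => intro v hv; rw [add_mulVec]; simp only [Pi.add_apply, Finset.sum_add_distrib, ih v hv, ih' v hv, add_zero]
  | mul X X' _ _ ih ih' => intro v hv; rw [← mulVec_mulVec]; exact ih _ (ih' v hv)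

omit [DecidableEq ι] in
/-- **`(X·v)^ = X̂·v̂`**: reading an integral matrix–vector product over `S`. [folklore] -/
theorem map_intCast_mulVec (C : Matrix ι ι ℤ) (v : ι → ℤ) :
    (fun c ↦ ((C *ᵥ v) c : S)) = C.map (Int.castRingHom S) *ᵥ fun c ↦ (v c : S) := by
  funext c
  have h := RingHom.map_mulVec (Int.castRingHom S) C v c
  simpa [Function.comp_def] using h

/-- **Monomials in the restricted generators are restrictions of elements of `ℤ[G]`.** Let `M ≤ S^ι` and `s' ⊆ End_S M` be a set of
endomorphisms each of which acts as `X̂` for some `X ∈ G`. Then every element of the multiplicative closure of `s'` acts as `Ĉ` for some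
`C ∈ ℤ[G]` — hence (`Algebra.adjoin_eq_span`) `S[s']` is the `S`-span of such operators. [folklore] -/
theorem exists_mem_adjoin_of_mem_closure (M : Submodule S (ι → S)) (G : Set (Matrix ι ι ℤ)) (s' : Set (Module.End S M))
    (hs' : ∀ f ∈ s', ∃ X ∈ G, ∀ m : M, ((f m : M) : ι → S) = X.map (Int.castRingHom S) *ᵥ (m : ι → S))
    {f : Module.End S M} (hf : f ∈ Submonoid.closure s') :
    ∃ C ∈ Algebra.adjoin ℤ G, ∀ m : M, ((f m : M) : ι → S) = C.map (Int.castRingHom S) *ᵥ (m : ι → S) := by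
  induction hf using Submonoid.closure_induction with
  | mem f hf =>
      obtain ⟨X, hX, h⟩ := hs' f hf
      exact ⟨X, Algebra.subset_adjoin hX, h⟩
  | one => exact ⟨1, Subalgebra.one_mem _, fun m ↦ by rw [Matrix.map_one _ (map_zero _) (map_one _), one_mulVec]; rfl⟩
  | mul f f' _ _ ih ih' =>
      obtain ⟨C, hC, h⟩ := ih
      obtain ⟨C', hC', h'⟩ := ih'
      refine ⟨C * C', Subalgebra.mul_mem _ hC hC', fun m ↦ ?_⟩
      rw [Module.End.mul_apply, h, h', mulVec_mulVec, Matrix.map_mul]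

/-- **`S[s']` is spanned by operators acting as `Ĉ`, `C ∈ ℤ[G]`.** [folklore] -/
theorem mem_span_of_mem_adjoin_restricted (M : Submodule S (ι → S)) (G : Set (Matrix ι ι ℤ)) (s' : Set (Module.End S M))
    (hs' : ∀ f ∈ s', ∃ X ∈ G, ∀ m : M, ((f m : M) : ι → S) = X.map (Int.castRingHom S) *ᵥ (m : ι → S))
    {a : Module.End S M} (ha : a ∈ Algebra.adjoin S s') :
    a ∈ Submodule.span S {f : Module.End S M |
      ∃ C ∈ Algebra.adjoin ℤ G, ∀ m : M, ((f m : M) : ι → S) = C.map (Int.castRingHom S) *ᵥ (m : ι → S)} := by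
  have ha' : a ∈ Subalgebra.toSubmodule (Algebra.adjoin S s') := ha
  rw [Algebra.adjoin_eq_span] at ha'
  refine Submodule.span_mono (fun f hf ↦ ?_) ha'
  exact exists_mem_adjoin_of_mem_closure M G s' hs' hf

end DegreeZero

section Saturated

variable {ι : Type*} [Fintype ι] [DecidableEq ι]

/-- **A saturated sublattice of `ℤ^ι` is the kernel of an integer matrix.** If `Y ≤ ℤ^ι` is saturated (`k v ∈ Y`, `k ≠ 0` ⟹ `v ∈ Y`), then
`ℤ^ι/Y` is torsion-free, hence free over the PID `ℤ`, and `Y` is the kernel of the coordinate map of the quotient: an integer matrix `C`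
with `r = rank(ℤ^ι/Y)` rows. In the derivation `Y = X_r(J′) ≤ X_q(J_0(qrM))` (Ribet's `∂` has torsion-free cokernel).
[cite: BourbakiAlgebraI1989, Ch. VII §4 no. 3 Cor. 1 (submodules of free modules over a PID)] -/
theorem exists_matrix_mem_iff_mulVec_eq_zero (Y : Submodule ℤ (ι → ℤ))
    (hsat : ∀ (k : ℤ) (v : ι → ℤ), k ≠ 0 → k • v ∈ Y → v ∈ Y) :
    ∃ (r : ℕ) (C : Matrix (Fin r) ι ℤ), ∀ v : ι → ℤ, v ∈ Y ↔ C *ᵥ v = 0 := by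
  classical
  haveI : Module.Finite ℤ ((ι → ℤ) ⧸ Y) := Module.Finite.quotient ℤ Y
  haveI : Module.IsTorsionFree ℤ ((ι → ℤ) ⧸ Y) := by
    refine Module.IsTorsionFree.of_smul_eq_zero fun k q hkq ↦ ?_
    by_cases hk : k = 0
    · exact Or.inl hk
    · right
      obtain ⟨v, rfl⟩ := Submodule.mkQ_surjective Y q
      rw [← map_smul, Submodule.mkQ_apply, Submodule.Quotient.mk_eq_zero] at hkq
      rw [Submodule.mkQ_apply, Submodule.Quotient.mk_eq_zero]
      exact hsat k v hk hkq
  haveI : Module.Free ℤ ((ι → ℤ) ⧸ Y) := Module.free_of_finite_type_torsion_free'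
  let bQ := Module.finBasis ℤ ((ι → ℤ) ⧸ Y)
  let L : (ι → ℤ) →ₗ[ℤ] (Fin (Module.finrank ℤ ((ι → ℤ) ⧸ Y)) → ℤ) := bQ.equivFun.toLinearMap ∘ₗ Y.mkQ
  refine ⟨Module.finrank ℤ ((ι → ℤ) ⧸ Y), LinearMap.toMatrix' L, fun v ↦ ?_⟩
  rw [← Matrix.toLin'_apply, Matrix.toLin'_toMatrix']
  change v ∈ Y ↔ bQ.equivFun (Y.mkQ v) = 0
  rw [map_eq_zero_iff _ bQ.equivFun.injective, Submodule.mkQ_apply, Submodule.Quotient.mk_eq_zero]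

omit [DecidableEq ι] in
/-- **A functional on a saturated sublattice extends to `ℤ^ι`.** If `Y ≤ ℤ^ι` is saturated then `ℤ^ι/Y` is free, so `Y` is a direct
summand and every `pf : Y → ℤ` is the restriction of some `Ψ : ℤ^ι → ℤ`. In the derivation `pf = π_*` on `Y = X_r(J′)` and `Ψ` is the
integral functional through which `P = π^*π_*` is read as an integer matrix `v ↦ Ψ(v)·π^*1` on all of `ℤ^{Cls O}`.
[cite: BourbakiAlgebraI1989, Ch. II §1 no. 9 Prop. 15, Ch. VII §4 no. 3 Cor. 1] -/
theorem exists_extension_of_saturated (Y : Submodule ℤ (ι → ℤ))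
    (hsat : ∀ (k : ℤ) (v : ι → ℤ), k ≠ 0 → k • v ∈ Y → v ∈ Y) (pf : Y →ₗ[ℤ] ℤ) :
    ∃ Ψ : (ι → ℤ) →ₗ[ℤ] ℤ, ∀ (y : ι → ℤ) (hy : y ∈ Y), Ψ y = pf ⟨y, hy⟩ := by
  classical
  haveI : Module.Finite ℤ ((ι → ℤ) ⧸ Y) := Module.Finite.quotient ℤ Y
  haveI : Module.IsTorsionFree ℤ ((ι → ℤ) ⧸ Y) := by
    refine Module.IsTorsionFree.of_smul_eq_zero fun k q hkq ↦ ?_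
    by_cases hk : k = 0
    · exact Or.inl hk
    · right
      obtain ⟨v, rfl⟩ := Submodule.mkQ_surjective Y q
      rw [← map_smul, Submodule.mkQ_apply, Submodule.Quotient.mk_eq_zero] at hkq
      rw [Submodule.mkQ_apply, Submodule.Quotient.mk_eq_zero]
      exact hsat k v hk hkq
  haveI : Module.Free ℤ ((ι → ℤ) ⧸ Y) := Module.free_of_finite_type_torsion_free'
  obtain ⟨σ, hσ⟩ := Module.projective_lifting_property Y.mkQ (LinearMap.id : ((ι → ℤ) ⧸ Y) →ₗ[ℤ] ((ι → ℤ) ⧸ Y))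
    (Submodule.mkQ_surjective Y)
  -- the projection `v ↦ v − σ(v mod Y)` onto `Y`
  let π₀ : (ι → ℤ) →ₗ[ℤ] (ι → ℤ) := LinearMap.id - σ ∘ₗ Y.mkQ
  have hπ₀ : ∀ v, π₀ v ∈ Y := by
    intro v
    have hσv : Y.mkQ (σ (Y.mkQ v)) = Y.mkQ v := LinearMap.congr_fun hσ (Y.mkQ v)
    have h1 : Y.mkQ (π₀ v) = 0 := by
      have : π₀ v = v - σ (Y.mkQ v) := rfl
      rw [this, map_sub, hσv, sub_self]
    rwa [Submodule.mkQ_apply, Submodule.Quotient.mk_eq_zero] at h1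
  refine ⟨pf ∘ₗ LinearMap.codRestrict Y π₀ hπ₀, fun y hy ↦ ?_⟩
  rw [LinearMap.comp_apply]
  congr 1
  apply Subtype.ext
  rw [LinearMap.codRestrict_apply]
  have h0 : Y.mkQ y = 0 := by rw [Submodule.mkQ_apply, Submodule.Quotient.mk_eq_zero]; exact hy
  have : π₀ y = y - σ (Y.mkQ y) := rfl
  rw [this, h0, map_zero, sub_zero]

variable {S : Type*} [CommRing S] [Module.Flat ℤ S]

/-- **`ker Ĉ` is the `S`-span of the image of `ker C`** (p812051 read for `Y = ker C`): for `v ∈ S^ι` with `Ĉ·v = 0`, `v` is an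
`S`-combination of images of vectors of `Y`. [cite: Matsumura1987, Thm. 7.6] -/
theorem mem_span_image_of_mem_ker {r : ℕ} (C : Matrix (Fin r) ι ℤ) (Y : Submodule ℤ (ι → ℤ))
    (hY : ∀ v : ι → ℤ, v ∈ Y ↔ C *ᵥ v = 0) (v : ι → S) (hv : C.map (Int.castRingHom S) *ᵥ v = 0) :
    v ∈ Submodule.span S ((fun w : ι → ℤ ↦ fun c ↦ (w c : S)) '' (Y : Set (ι → ℤ))) := by
  have hv' : (C.map (algebraMap ℤ S)) *ᵥ v = 0 := by rwa [algebraMap_int_eq]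
  have h := mem_span_image_of_map_mulVec_eq_zero (R := ℤ) (S := S) C v hv'
  have hfun : (fun w : ι → ℤ ↦ fun i ↦ algebraMap ℤ S (w i)) = (fun w : ι → ℤ ↦ fun c ↦ (w c : S)) := by
    funext w c
    exact eq_intCast (algebraMap ℤ S) (w c)
  have hsetY : {w : ι → ℤ | C *ᵥ w = 0} = (Y : Set (ι → ℤ)) := Set.ext fun w ↦ (hY w).symm
  rw [hfun, hsetY] at h
  exact h

end Saturated

end Summit.BirchSwinnertonDyer.BirchSwinnertonDyer.Theorems.LeafPartnerOrders

end
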